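import Literature.Computability.Complexity.CircuitClassesProofs
import HarnessLib

/-!
# `(P/poly)/poly ⊆ P/poly`: polynomial advice is absorbed by circuits (trunk CplxCore)

Two structural facts about the advice operator `polyAdvice` (`C ↦ C/poly`, Arora–Barak 2009,
Def. 6.16; `Literature.Computability.Complexity.CircuitClasses`) over the tree's circuit class
`PPoly` (Def. 6.5), both PROVED:

* `polyAdvice_mono : C ⊆ C' → C/poly ⊆ C'/poly` (immediate from the definition);
* `polyAdvice_PPoly_subset_PPoly : (P/poly)/poly ⊆ P/poly`: for `L ∈ (P/poly)/poly` with witness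
  `L' ∈ P/poly` (circuits of size `q`) and advice `a(n)`, `|a(n)| ≤ p(n)`, the map
  `(x, y) ↦ [⟨x, y⟩ ∈ L']` on `n + |a(n)|` bits has circuits of size `N + q(N)`,
  `N = 2n + 2 + |a(n)|` (`exists_cktSize_boolPair_of_mem_PPoly`), and hardwiring `y := a(n)`
  (`CktSize.hardwire`) yields a family of size `≤ (2n+2+p(n)) + q(2n+2+p(n)) + 2` deciding `L`
  (Arora–Barak 2009, proof of Thm. 6.18, direction "⊇": the advice is hardwired into the
  circuit; Karp–Lipton 1980).

Corollary `polyAdvice_subset_PPoly`: `K ⊆ P/poly → K/poly ⊆ P/poly`, the form in which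
"`CH ⊆ P/poly` hence `CH/poly ⊆ P/poly`" is used in Bürgisser 2009 (Lemma 2.5) and Tavenas 2014
(Lemma 3.9); consumer: `Literature.Computability.AlgebraicComplexity.RealTauConjectureProofs`.

## References

* S. Arora, B. Barak, *Computational Complexity: A Modern Approach*, CUP 2009, Def. 6.5,
  Def. 6.16, Thm. 6.18 (`P/poly` = polynomial time with polynomial advice).
* R. M. Karp, R. J. Lipton, *Some connections between nonuniform and uniform complexity
  classes*, STOC 1980, 302–309.
-/

namespace Literature.Computability.Complexity

open Polynomial

/-- The advice operator is monotone: `C ⊆ C'` gives `C/poly ⊆ C'/poly` (immediate from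
Arora–Barak 2009, Def. 6.16). [cite: AroraBarak2009, Def. 6.16] -/
theorem polyAdvice_mono {C C' : Set (Language Bool)} (h : C ⊆ C') : polyAdvice C ⊆ polyAdvice C' := by
  rintro L ⟨L', hL', a, p, hp, hL⟩
  exact ⟨L', h hL', a, p, hp, hL⟩

/-- Membership bits agree along an equivalence of memberships: `(x ∈ L ↔ y ∈ L')` gives
`[x ∈ L] = [y ∈ L']`. [folklore] -/
theorem boolIndicator_eq_of_iff {L L' : Language Bool} {x y : List Bool} (h : x ∈ L ↔ y ∈ L') :
    L.boolIndicator x = L'.boolIndicator y := by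
  by_cases hx : x ∈ L
  · rw [(Set.mem_iff_boolIndicator _ _).1 hx, (Set.mem_iff_boolIndicator _ _).1 (h.1 hx)]
  · rw [(Set.notMem_iff_boolIndicator _ _).1 hx,
      (Set.notMem_iff_boolIndicator _ _).1 fun hy => hx (h.2 hy)]

/-- **`(P/poly)/poly ⊆ P/poly`**: polynomial advice on top of polynomial-size circuits can be
hardwired into the circuits (Arora–Barak 2009, proof of Thm. 6.18, "⊇"; Karp–Lipton 1980). The
size polynomial is `(2X + 2 + p) + q ∘ (2X + 2 + p) + 2` for advice length `≤ p` and circuits of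
size `≤ q` for the witness language. [cite: AroraBarak2009, Thm. 6.18] -/
theorem polyAdvice_PPoly_subset_PPoly : polyAdvice PPoly ⊆ PPoly := by
  classical
  rintro L ⟨L', hL', a, p, hp, hL⟩
  obtain ⟨q, hq⟩ := exists_cktSize_boolPair_of_mem_PPoly hL'
  -- monotonicity of `q.eval` over `ℕ`
  have hqmono : ∀ {x y : ℕ}, x ≤ y → q.eval x ≤ q.eval y := fun {x y} h => by
    rw [eval_eq_sum_range, eval_eq_sum_range]
    exact Finset.sum_le_sum fun i _ => Nat.mul_le_mul_left _ (Nat.pow_le_pow_left h i)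
  let Np : Polynomial ℕ := 2 * X + 2 + p
  let r : Polynomial ℕ := Np + q.comp Np + 2
  have hr : ∀ n, r.eval n = (2 * n + 2 + p.eval n) + q.eval (2 * n + 2 + p.eval n) + 2 := by
    intro n
    simp [r, Np, eval_comp]
  have main : ∀ n : ℕ, ∃ D : Circuit (Fin n), D.IsOver B2 ∧ D.size ≤ r.eval n ∧
      ∀ u : Fin n → Bool, D.eval u = L.boolIndicator (List.ofFn u) := by
    intro n
    -- the circuit on pairs `(x, y)`, `|y| = |a n|`, with `y` hardwired to `a n`
    obtain ⟨D, hDB, hDs, hDe⟩ := ((hq n (a n).length).hardwire (a n).get).toCircuit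
    refine ⟨D, hDB, hDs.trans ?_, fun u => (hDe u).trans ?_⟩
    · rw [hr n]
      have h1 : 2 * n + 2 + (a n).length ≤ 2 * n + 2 + p.eval n := by have := hp n; omega
      have h2 := hqmono h1
      omega
    · simp only [Sum.elim_inl, Sum.elim_inr, List.ofFn_get]
      exact boolIndicator_eq_of_iff ((hL (List.ofFn u)).trans (by rw [List.length_ofFn])).symm
  choose D hD using main
  refine Set.mem_iUnion.2 ⟨r, D, fun n => ⟨(hD n).1, (hD n).2.1⟩, fun x => ?_⟩
  have := (hD x.length).2.2 x.get
  rwa [List.ofFn_get] at this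

/-- `K ⊆ P/poly` implies `K/poly ⊆ P/poly` (monotonicity of advice and
`polyAdvice_PPoly_subset_PPoly`); e.g. `CH ⊆ P/poly ⇒ CH/poly ⊆ P/poly` as used in
Bürgisser 2009, Lemma 2.5 and Tavenas 2014, Lemma 3.9. [cite: AroraBarak2009, Thm. 6.18] -/
theorem polyAdvice_subset_PPoly {K : Set (Language Bool)} (h : K ⊆ PPoly) : polyAdvice K ⊆ PPoly :=
  (polyAdvice_mono h).trans polyAdvice_PPoly_subset_PPoly

end Literature.Computability.Complexity
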